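/-
Copyright (c) 2026 the pub-hodgecm-mathlib formalisation cell (harness21).  Prover seat hodgecm-mathlib-LH7-p08 (g0) (re-dealt to strike line L3 `stub_N6nsDyadic` by director
s1969 (a)), Track A «(D-RAM) FOUR-FRAME» squad, helper lane on h413 = stmt-HodgeConjecture-24833 (count-neutral).  β-BOARD v1 row R8 ∕ (P5) «H `(2ρ,2ρ,2ρ)`», FILE 5c: the
character sums over the admissible classes that the SHALLOW keys `(m, m, L)`, `2 ≤ L − m ≤ 2d − 4`, need — the SUB-BREAK twisted sums `Σ_{g adm} ω(1 + δg) = 0` and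
`Σ_{g adm} ω(1+g)·ω(g + c) = 0` for `|δ| = |c − 1| = |ϖ|^s`, `1 ≤ s < 2d − 2`, `ρ + s ≥ 2d − 1` — and the shallow token letter `|e_A − e_B| = |ϖ|^s`.  2026-09-04.
-/
import Summits.HodgeConjecture.HodgeConjecture.Theorems.F0P3cDyRamAdmissibleShiftedCharacterSums      -- ★ p862049 (this seat, FILE 4b): `v_add_admissible`, `repr_admissible_image_add`, `repr_admissible_image_div`; brings ★ κH (B1a) `…CharacterMaps` and the ★ ω-conductor toolkit (§5 `sum_normSign_repr_eq_zero`)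
import Summits.HodgeConjecture.HodgeConjecture.Theorems.F0P3cDyRamFourFramePieces                     -- ★ `mstarOfRecord`
import Literature.NumberTheory.LocalFields.WildQuadraticDatumRefSkewScalar                             -- ★ `v_refSkewScalar`
import Mathlib.Algebra.BigOperators.Finprod
import HarnessLib

/-!
# Crux `H413`, line LH4 «(D-RAM) FOUR-FRAME» — (β) table, β-BOARD row R8 ∕ (P5), FILE 5c: «THE SUB-BREAK CHARACTER SUMS OVER THE ADMISSIBLE CLASSES AND THE SHALLOW TOKEN LETTER»

Cell `hodgecm-mathlib` (D-0151), FLOOR 0, crux item H413 = `stmt-HodgeConjecture-24833`, route `HCCMUnconditional`; squad F0∕P3c∕LH4 (β chair LH4-p05 (g9)).  THEOREMS ONLY (no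
`def`, no instance, no notation, no `sorry`, default heartbeats); ★-only imports; lane `--supports stmt-HodgeConjecture-24833 --as helper` (count-neutral); pays NO row, states NO law.

THE MATHEMATICS (this seat's MATH NOTE 2026-09-04T21:33:39Z on the LH4 bus, the SHALLOW keys `(m, m, L)`, `s_g := L − m ∈ [2, 2d−4]`).  On a core-hanging orbit with exact invariant
`g` (admissible: `|g| = |1+g| = 1`) the (β) label is read through the character `θ` of ★ FILE 5b, and by ★ FILE 5a's HEAD′ and FILE 5b′'s windows the per-lattice value is
`w∕2·(ω(g)·ε·ι, ε·ι, ω(−(1+g))·ε·J)`, `ε = ω(g·g_α + g_β) = ω(g_α)·ω(g + c)`, `c = g_β∕g_α = 1 + δ`, `|δ| = |ϖ|^{s_g}` (§0 below), `ι = [2d−1 ≤ ρ]`, `J = [ρ + s_g ≥ 2d−1]`.  Summing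
over the admissible classes modulo `𝔭^ρ` needs, besides ★ FILE 4b's two shifted sums (slots `0, 1`, alive window — they only ask `|c − 1| < 1`), ONE new sum for slot `2` in the
window `J = 1`:
* §1 **`Σ_{g ∈ S} ω(1 + δg) = 0`** for `δ` fixed, `|δ| = |ϖ|^s`, `1 ≤ s < 2d − 2`, `ρ + s ≥ 2d − 1`, over any complete irredundant system `S` of representatives modulo `𝔭^ρ` of the
  admissible fixed units.  PROOF: `y = 1 + δg` carries `S` to a complete irredundant system modulo `𝔭^{ρ+s}` (`ρ + s ≥ 2d−1`) of the set `A = 1 + δ·Adm`, which consists of fixed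
  units and is STABLE under `U_F(2d−2)` (`a(1 + δf) = 1 + δf′`, `f′ − f = (a−1)(1+δf)∕δ ∈ 𝔭^{2d−2−s} ⊆ 𝔭` as `s < 2d−2`); ★ toolkit §5 (`Σ_S ω = 0` on such systems: the break
  non-norm `c′ ∈ U_F(2d−2)` permutes the classes and flips `ω`).  No additivity of `x ↦ ω(1 + δx)` is used (it fails below the break).
* §2 **`Σ_{g ∈ S} ω(1 + g)·ω(g + c) = 0`** for `c` fixed with `|c − 1| = |ϖ|^s` (same window): `(1 + g)(g + c) = (1 + δ∕(1+g))·(1+g)σ(1+g)`, so the summand is `ω(1 + δ·(1∕(g+1)))`, and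
  `g ↦ g + 1 ↦ 1∕(g + 1)` transports `S` (★ FILE 4b §1 with `c = 1`); then §1.
* §0 **THE SHALLOW TOKEN LETTER**: tower-sign tokens `e, e′` of `α − 1`, `β − 1` at the same depth parameter `n` with `|β − α| = |ϖ|^{n+s}`, `s ≤ 2d − 2`, satisfy `|e − e′| = |ϖ|^s`
  EXACTLY (★ FILE 4c′ §0 is `s = 2d − 2`; the term `ϖ^{−m*}(β − α)π₀^{−k}` of valuation `|ϖ|^{s − 2d + 1} > 1` dominates the two token errors).
HONEST LABEL.  Count-neutral (`--supports`); the shallow H rows (FILEs 5d′∕5d), the equilateral key, `hRest`, (T3), (β-BAL), (β), T₊ stay OPEN; `HC_CM` is proved only modulo the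
7 printed citations (2 remaining named inputs: hLiu418 = `stmt-HodgeConjecture-24832`, h413 = `stmt-HodgeConjecture-24833`) until rung 0 closes.

## References
* [Kottwitz1986BaseChangeUnits] R. E. Kottwitz, *Base change for unit elements of Hecke algebras*, Compositio Math. 60 (1986), §1 pp. 240–241 (signed lattice counts modulo the torus).
* [Serre1979] J.-P. Serre, *Local Fields*, GTM 67 (1979), Ch. V §3 Prop. 5, Cor. 2–3 pp. 84–86; Ch. XV §2 (the conductor of the quadratic character of a ramified quadratic extension).
* [Rogawski1990] J. D. Rogawski, *Automorphic Representations of Unitary Groups in Three Variables*, Ann. of Math. Stud. 123 (1990), §4.9 p. 55, §4.10 p. 58.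
-/

set_option autoImplicit false

noncomputable section

namespace Summit.HodgeConjecture.HodgeConjecture.Cruxes.H413.F0P3cDyRamAdmissibleSubBreakCharacterSum

open WithZero Matrix
open Literature.NumberTheory.Automorphic.UnitaryThreeFourFrame
open Literature.NumberTheory.LocalFields Literature.NumberTheory.LocalFields.WildQuadraticDatum
open Summit.HodgeConjecture.HodgeConjecture.Cruxes.H413.F0P3cDyRamFourFramePieces
open Summit.HodgeConjecture.HodgeConjecture.Cruxes.H413.F0P3cDyRamFixedCountDiagonalModel (normSign_mul_norm)
open Summit.HodgeConjecture.HodgeConjecture.Cruxes.H413.F0P3cDyRamDiagonalKappaCoreHangingCharacterMaps (v_add_eq_one_of_lt)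
open Summit.HodgeConjecture.HodgeConjecture.Cruxes.H413.F0P3cDyRamAdmissibleShiftedCharacterSums (v_add_admissible v_div_admissible repr_admissible_image_add repr_admissible_image_div)
open scoped Valued

variable {K : Type} [Field K] [Valued K ℤᵐ⁰]

/-! ## §0  The shallow token letter: two same-depth tokens are EXACTLY `𝔭^s` apart when `|β − α| = |ϖ|^{n+s}`, `s ≤ 2d − 2` -/

/-- **`|e − e′| = |ϖ|^s`** for tower-sign tokens `e` of `α − 1` and `e′` of `β − 1` at the same depth parameter `n ≡ d (mod 2)` when `|β − α| = |ϖ|^L` with `L = n + s`, `s ≤ 2d − 2`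
(the SHALLOW keys and the boundary): in the ★ token identity `ϖ^{−m*}(e − e′)t₊ = −(err_α) + (err_β) − ϖ^{−m*}(β − α)π₀^{−k}` the last term has valuation `|ϖ|^{s−2d+1} > 1` and dominates
the two errors (`≤ 1`).  ★ FILE 4c′ §0 is the case `s = 2d − 2`. [cite: Serre1979, Ch. V §3] [cite: Rogawski1990, §4.9 p. 55] -/
theorem v_towerSign_sub_eq_of_sub {σ : K →+* K} {ϖ : K} {d t : ℕ} (hD : IsRamifiedQuadraticDatum σ ϖ d t)
    {α β : K} {n L s : ℕ} (hvβα : Valued.v (β - α) = Valued.v ϖ ^ L) (hL : L = n + s) (hs : s ≤ 2 * d - 2) (hn : d % 2 ≤ n) (hpar : n % 2 = d % 2)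
    {e e' : K}
    (he : Valued.v ((ϖ ^ mstarOfRecord d)⁻¹ * ((α - 1) * ((ϖ * σ ϖ) ^ ((n - d % 2) / 2))⁻¹ - e * ((ϖ - σ ϖ) * ((ϖ * σ ϖ) ^ ((d - d % 2) / 2))⁻¹))) ≤ 1)
    (he' : Valued.v ((ϖ ^ mstarOfRecord d)⁻¹ * ((β - 1) * ((ϖ * σ ϖ) ^ ((n - d % 2) / 2))⁻¹ - e' * ((ϖ - σ ϖ) * ((ϖ * σ ϖ) ^ ((d - d % 2) / 2))⁻¹))) ≤ 1) :
    Valued.v (e - e') = Valued.v ϖ ^ s := by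
  obtain ⟨hσ, hvσ, hϖ, -, hd, h1d, -⟩ := id hD
  have hϖ0 : ϖ ≠ 0 := fun h => by rw [h, map_zero] at hϖ; exact (coe_ne_zero hϖ.symm).elim
  have hvϖ0 : Valued.v ϖ ≠ 0 := (Valuation.ne_zero_iff _).2 hϖ0
  obtain ⟨k, hnk⟩ : ∃ k : ℕ, n = 2 * k + d % 2 := ⟨n / 2, by omega⟩
  have hk : (n - d % 2) / 2 = k := by omega
  rw [hk] at he he'
  set P : K := ((ϖ * σ ϖ) ^ k)⁻¹ with hPdef
  set tp : K := (ϖ - σ ϖ) * ((ϖ * σ ϖ) ^ ((d - d % 2) / 2))⁻¹ with htpdef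
  set M : K := (ϖ ^ mstarOfRecord d)⁻¹ with hMdef
  have hvtp : Valued.v tp = Valued.v ϖ ^ (d % 2) := by rw [htpdef, v_refSkewScalar hvσ hϖ hd, v_varpi_pow hϖ]
  have hvP : Valued.v P = (Valued.v ϖ ^ (2 * k))⁻¹ := by rw [hPdef, map_inv₀, map_pow, map_mul, hvσ, ← pow_two, ← pow_mul]
  have hvM : Valued.v M = (Valued.v ϖ ^ mstarOfRecord d)⁻¹ := by rw [hMdef, map_inv₀, map_pow]
  have hid : M * ((e - e') * tp) = (-(M * ((α - 1) * P - e * tp)) + M * ((β - 1) * P - e' * tp)) + -(M * ((β - α) * P)) := by ring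
  -- the dominating term: `|M(β−α)P| = |ϖ|^{s − 2d + 1} > 1`
  have hm : mstarOfRecord d = 2 * d - 1 + d % 2 := by unfold mstarOfRecord; omega
  have h3 : Valued.v (-(M * ((β - α) * P))) = exp (((2 * d : ℕ) : ℤ) - 1 - (s : ℤ)) := by
    rw [Valuation.map_neg, map_mul, map_mul, hvM, hvP, hvβα, hm, hL, v_varpi_pow hϖ, v_varpi_pow hϖ, v_varpi_pow hϖ, ← WithZero.exp_neg, ← WithZero.exp_neg,
      ← WithZero.exp_add, ← WithZero.exp_add]
    congr 1; push_cast; omega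
  have h12 : Valued.v (-(M * ((α - 1) * P - e * tp)) + M * ((β - 1) * P - e' * tp)) ≤ 1 := by
    refine (Valuation.map_add _ _ _).trans (max_le ?_ he')
    rw [Valuation.map_neg]; exact he
  have hlt : Valued.v (-(M * ((α - 1) * P - e * tp)) + M * ((β - 1) * P - e' * tp)) < Valued.v (-(M * ((β - α) * P))) := by
    rw [h3]; refine h12.trans_lt ?_
    rw [← exp_zero, exp_lt_exp]; omega
  have htot : Valued.v (M * ((e - e') * tp)) = exp (((2 * d : ℕ) : ℤ) - 1 - (s : ℤ)) := by
    rw [hid, add_comm, Valuation.map_add_eq_of_lt_left _ hlt, h3]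
  rw [map_mul, map_mul, hvM, hvtp] at htot
  -- solve for `|e − e′|`
  have hM0 : (Valued.v ϖ ^ mstarOfRecord d) ≠ 0 := pow_ne_zero _ hvϖ0
  have hT0 : (Valued.v ϖ ^ (d % 2)) ≠ 0 := pow_ne_zero _ hvϖ0
  rw [inv_mul_eq_iff_eq_mul₀ hM0, ← eq_mul_inv_iff_mul_eq₀ hT0] at htot
  rw [htot, hm, v_varpi_pow hϖ, v_varpi_pow hϖ, v_varpi_pow hϖ, ← WithZero.exp_neg, ← WithZero.exp_add, ← WithZero.exp_add]
  congr 1; push_cast; omega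

/-! ## §1  The sub-break twisted sum `Σ_S ω(1 + δg) = 0` (`|δ| = |ϖ|^s`, `1 ≤ s < 2d − 2`, `ρ + s ≥ 2d − 1`) -/

/-- **`Σ_{g ∈ S} ω(1 + δg) = 0`** — ramified datum on a complete field with finite residue field, `|2| < 1`; `δ` fixed with `|δ| = |ϖ|^s`, `1 ≤ s < 2d − 2` (strictly below the break),
`ρ + s ≥ 2d − 1`; `S` any complete irredundant system of representatives modulo `𝔭^ρ` of the admissible fixed units `{|g| = |1+g| = 1}`.  (`1 + δ·S` is a complete irredundant system
modulo `𝔭^{ρ+s}` of the `U_F(2d−2)`-stable set `1 + δ·Adm` of fixed units; ★ toolkit §5.) [cite: Serre1979, Ch. V §3 Cor. 3; Ch. XV §2] [cite: Kottwitz1986BaseChangeUnits, §1 pp. 240–241] -/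
theorem sum_normSign_one_add_mul_eq_zero_of_subBreak [CompleteSpace K] [Finite 𝓀[K]] {σ : K →+* K} {ϖ : K} {d t : ℕ}
    (hD : IsRamifiedQuadraticDatum σ ϖ d t) (h2 : Valued.v (2 : K) < 1) {ρ s : ℕ} (hs : 1 ≤ s) (hsd : s < 2 * d - 2) (hρs : 2 * d - 1 ≤ ρ + s)
    {δ : K} (hσδ : σ δ = δ) (hδ : Valued.v δ = Valued.v ϖ ^ s)
    (S : Finset K) (hS1 : ∀ g ∈ S, σ g = g ∧ Valued.v g = 1 ∧ Valued.v (1 + g) = 1)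
    (hS2 : ∀ f : K, σ f = f → Valued.v f = 1 → Valued.v (1 + f) = 1 → ∃ g ∈ S, Valued.v (f - g) ≤ Valued.v ϖ ^ ρ)
    (hS3 : ∀ g ∈ S, ∀ g' ∈ S, Valued.v (g - g') ≤ Valued.v ϖ ^ ρ → g = g') :
    ∑ g ∈ S, normSign σ (1 + δ * g) = 0 := by
  classical
  obtain ⟨hσ, hvσ, hϖ, hfix, hd, hd1, -⟩ := id hD
  have hϖ1 : Valued.v ϖ < 1 := by rw [hϖ, ← exp_zero, exp_lt_exp]; norm_num
  have hvϖ0 : Valued.v ϖ ≠ 0 := by rw [hϖ]; exact coe_ne_zero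
  have hps0 : Valued.v ϖ ^ s ≠ 0 := pow_ne_zero _ hvϖ0
  have hδ1 : Valued.v δ < 1 := by rw [hδ]; exact pow_lt_one₀ zero_le hϖ1 (by omega)
  have hδ0 : δ ≠ 0 := fun h => hps0 (by rw [← hδ, h, map_zero])
  have hvδ0 : Valued.v δ ≠ 0 := (Valuation.ne_zero_iff _).2 hδ0
  -- below the break: `|a − 1| ≤ |ϖ|^{2d−2} < |δ|`
  have hbreak : exp (-(2 * ((d - 1 : ℕ) : ℤ))) < Valued.v δ := by
    rw [hδ, v_varpi_pow hϖ, exp_lt_exp]; omega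
  -- `|δf| < 1` and `|1 + δf| = 1` for a unit `f`
  have hunit : ∀ f : K, Valued.v f = 1 → Valued.v (1 + δ * f) = 1 := fun f hf =>
    v_add_eq_one_of_lt (map_one _) (by rw [map_mul, hf, mul_one]; exact hδ1)
  -- `g ↦ 1 + δg` is injective
  have hinj : Set.InjOn (fun g : K => 1 + δ * g) ↑S := fun g _ g' _ h => by
    have h' : 1 + δ * g = 1 + δ * g' := h
    exact mul_left_cancel₀ hδ0 (add_left_cancel h')
  rw [← Finset.sum_image hinj]
  refine sum_normSign_repr_eq_zero hD h2 hρs (A := {y : K | ∃ f : K, σ f = f ∧ Valued.v f = 1 ∧ Valued.v (1 + f) = 1 ∧ y = 1 + δ * f}) ?_ ?_ _ ?_ ?_ ?_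
  · -- `A` consists of fixed units
    rintro y ⟨f, hσf, hf, -, rfl⟩
    exact ⟨by rw [map_add, map_one, map_mul, hσδ, hσf], hunit f hf⟩
  · -- `A` is stable under `U_F(2d−2)`: `a(1 + δf) = 1 + δ·(f + (a−1)(1+δf)∕δ)`
    rintro y ⟨f, hσf, hf, h1f, rfl⟩ a hσa ha ha1
    have hsmall : Valued.v ((a - 1) * (1 + δ * f) / δ) < 1 := by
      rw [map_div₀, map_mul, hunit f hf, mul_one, div_lt_one₀ ((Valuation.pos_iff _).2 hδ0)]
      exact ha1.trans_lt hbreak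
    refine ⟨f + (a - 1) * (1 + δ * f) / δ, ?_, v_add_eq_one_of_lt hf hsmall, ?_, ?_⟩
    · rw [map_add, map_div₀, map_mul, map_sub, map_one, map_add, map_one, map_mul, hσa, hσδ, hσf]
    · rw [← add_assoc]; exact v_add_eq_one_of_lt h1f hsmall
    · field_simp
      ring
  · -- `1 + δ·S ⊆ A`
    intro y hy
    obtain ⟨g, hg, rfl⟩ := Finset.mem_image.1 hy
    obtain ⟨hσg, hvg, h1g⟩ := hS1 g hg
    exact ⟨g, hσg, hvg, h1g, rfl⟩
  · -- completeness modulo `𝔭^{ρ+s}`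
    rintro y ⟨f, hσf, hf, h1f, rfl⟩
    obtain ⟨g, hg, hfg⟩ := hS2 f hσf hf h1f
    refine ⟨1 + δ * g, Finset.mem_image_of_mem _ hg, ?_⟩
    rw [show 1 + δ * f - (1 + δ * g) = δ * (f - g) by ring, map_mul, hδ, pow_add, mul_comm (Valued.v ϖ ^ ρ)]
    exact mul_le_mul' le_rfl hfg
  · -- irredundancy
    intro y hy y' hy' hle
    obtain ⟨g, hg, rfl⟩ := Finset.mem_image.1 hy
    obtain ⟨g', hg', rfl⟩ := Finset.mem_image.1 hy'
    rw [show 1 + δ * g - (1 + δ * g') = δ * (g - g') by ring, map_mul, hδ, pow_add, mul_comm (Valued.v ϖ ^ ρ)] at hle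
    have hle' : Valued.v (g - g') ≤ Valued.v ϖ ^ ρ := by
      have := mul_le_mul' (le_refl (Valued.v ϖ ^ s)⁻¹) hle
      rwa [← mul_assoc, ← mul_assoc, inv_mul_cancel₀ hps0, one_mul, one_mul] at this
    rw [hS3 g hg g' hg' hle']

/-! ## §2  The slot-`2` sum of the shallow rows: `Σ_S ω(1 + g)·ω(g + c) = 0` (`|c − 1| = |ϖ|^s`, same window) -/

/-- **`Σ_{g ∈ S} ω(1 + g)·ω(g + c) = 0`** — `c` fixed with `|c − 1| = |ϖ|^s`, `1 ≤ s < 2d − 2`, `ρ + s ≥ 2d − 1`; `S` any complete irredundant system of representatives modulo `𝔭^ρ` of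
the admissible fixed units.  (`ω(1+g)ω(g+c) = ω((1+g)(g+c)) = ω(1 + (c−1)·(1∕(g+1)))` since `(1+g)(g+c) = (1 + (c−1)∕(g+1))·(1+g)σ(1+g)`; the maps `g ↦ g + 1 ↦ 1∕(g + 1)` transport `S`
(★ FILE 4b §1 with `c = 1`); then §1.) [cite: Serre1979, Ch. V §3 Cor. 3; Ch. XV §2] [cite: Kottwitz1986BaseChangeUnits, §1 pp. 240–241] [cite: Rogawski1990, §4.10 p. 58] -/
theorem sum_normSign_one_add_mul_normSign_add_eq_zero_of_subBreak [CompleteSpace K] [Finite 𝓀[K]] {σ : K →+* K} {ϖ : K} {d t : ℕ}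
    (hD : IsRamifiedQuadraticDatum σ ϖ d t) (h2 : Valued.v (2 : K) < 1) {ρ s : ℕ} (hs : 1 ≤ s) (hsd : s < 2 * d - 2) (hρs : 2 * d - 1 ≤ ρ + s)
    {c : K} (hσc : σ c = c) (hc : Valued.v (c - 1) = Valued.v ϖ ^ s)
    (S : Finset K) (hS1 : ∀ g ∈ S, σ g = g ∧ Valued.v g = 1 ∧ Valued.v (1 + g) = 1)
    (hS2 : ∀ f : K, σ f = f → Valued.v f = 1 → Valued.v (1 + f) = 1 → ∃ g ∈ S, Valued.v (f - g) ≤ Valued.v ϖ ^ ρ)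
    (hS3 : ∀ g ∈ S, ∀ g' ∈ S, Valued.v (g - g') ≤ Valued.v ϖ ^ ρ → g = g') :
    ∑ g ∈ S, normSign σ (1 + g) * normSign σ (g + c) = 0 := by
  classical
  obtain ⟨hσ, hvσ, hϖ, hfix, hd, hd1, -⟩ := id hD
  have hϖ1 : Valued.v ϖ < 1 := by rw [hϖ, ← exp_zero, exp_lt_exp]; norm_num
  have hc1 : Valued.v (c - 1) < 1 := by rw [hc]; exact pow_lt_one₀ zero_le hϖ1 (by omega)
  have hσδ : σ (c - 1) = c - 1 := by rw [map_sub, map_one, hσc]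
  -- termwise: `ω(1+g)ω(g+c) = ω(1 + (c−1)·(1∕(g+1)))`
  have hterm : ∀ g ∈ S, normSign σ (1 + g) * normSign σ (g + c) = normSign σ (1 + (c - 1) * (1 / (g + 1))) := by
    intro g hg
    obtain ⟨hσg, hvg, h1g⟩ := hS1 g hg
    have h1g0 : 1 + g ≠ 0 := fun h => by rw [h, map_zero] at h1g; exact zero_ne_one h1g
    obtain ⟨hgc, -⟩ := v_add_admissible h2 hvg h1g hc1
    have hgc0 : g + c ≠ 0 := fun h => by rw [h, map_zero] at hgc; exact zero_ne_one hgc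
    have hg10 : g + 1 ≠ 0 := fun h => h1g0 (by rw [add_comm]; exact h)
    have hσ1g : σ (1 + g) = 1 + g := by rw [map_add, map_one, hσg]
    rw [← normSign_mul_of_fixed hD hσ1g (by rw [map_add, hσg, hσc]) h1g0 hgc0,
      show (1 + g) * (g + c) = (1 + (c - 1) * (1 / (g + 1))) * ((1 + g) * σ (1 + g)) by rw [hσ1g]; field_simp; ring,
      normSign_mul_norm σ _ h1g0]
  rw [Finset.sum_congr rfl hterm]
  -- transport `g ↦ g + 1`
  obtain ⟨hA1, hA2, hA3⟩ := repr_admissible_image_add (ϖ := ϖ) (ρ := ρ) h2 (map_one σ) (by rw [sub_self, map_zero]; exact zero_lt_one) S hS1 hS2 hS3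
  have hinjA : Set.InjOn (fun g : K => g + 1) ↑S := fun g _ g' _ h => by simpa using h
  -- transport `h ↦ 1∕h`
  obtain ⟨hB1, hB2, hB3⟩ := repr_admissible_image_div (ϖ := ϖ) (ρ := ρ) h2 (map_one σ) (by rw [sub_self, map_zero]; exact zero_lt_one) (S.image fun g : K => g + 1) hA1 hA2 hA3
  have hinjB : Set.InjOn (fun h : K => 1 / h) ↑(S.image fun g : K => g + 1) := by
    intro h hh h' hh' heq
    have heq' : 1 / h = 1 / h' := heq
    have hvh := (hA1 h hh).2.1
    have hvh' := (hA1 h' hh').2.1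
    have hh0 : h ≠ 0 := fun h0 => by rw [h0, map_zero] at hvh; exact zero_ne_one hvh
    have hh'0 : h' ≠ 0 := fun h0 => by rw [h0, map_zero] at hvh'; exact zero_ne_one hvh'
    rw [div_eq_div_iff hh0 hh'0, one_mul, one_mul] at heq'
    exact heq'.symm
  have hsum : ∑ g ∈ S, normSign σ (1 + (c - 1) * (1 / (g + 1))) = ∑ x ∈ (S.image fun g : K => g + 1).image (fun h : K => 1 / h), normSign σ (1 + (c - 1) * x) := by
    rw [Finset.sum_image hinjB, Finset.sum_image hinjA]
  rw [hsum]
  exact sum_normSign_one_add_mul_eq_zero_of_subBreak hD h2 hs hsd hρs hσδ hc _ hB1 hB2 hB3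

end Summit.HodgeConjecture.HodgeConjecture.Cruxes.H413.F0P3cDyRamAdmissibleSubBreakCharacterSum

end
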